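import Mathlib
import HarnessLib

/-!
# Stub `stub_ratioOfColdPressure` for the crux `WeakCouplingHypercubicLimit` (line `Sketch`)

**Cold pressure forces the spectral ratio** (the infinite-dimensional form of
`stub_pressureForcesGap`).  Non-negative weights `λᵢ ≤ λ_{i₀}` with `λ_{i₀} > 0` and
`Σ λᵢ² < ∞`; if the normalised trace excesses obey
`(Σᵢ λᵢ^{m+2}) / λ_{i₀}^{m+2} − 1 ≤ V C e^{−g (m+2)}` for all `m ≥ m₀` (any prefactor `V > 0`, any
`C`, any real `g`), then every other weight satisfies `λᵢ ≤ e^{−g} λ_{i₀}`.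

Proof (elementary real analysis): fix `i ≠ i₀` and put `ρ := λᵢ / λ_{i₀}`.  The family
`λⱼ^{m+2} ≤ λ_{i₀}^m λⱼ²` is summable, and keeping only the two non-negative terms `j = i, i₀`
gives `ρ^{m+2} ≤ (Σⱼ λⱼ^{m+2}) / λ_{i₀}^{m+2} − 1 ≤ V C e^{−g (m+2)}`, i.e.
`(ρ e^{g})^{m+2} ≤ V C` for all `m ≥ m₀`.  If `ρ > e^{−g}` then `q := ρ e^{g} > 1` and
`q^m → ∞`, a contradiction. [folklore]
-/

noncomputable section

open scoped BigOperators
open Finset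

namespace Summit.QuantumFields.YangMills.Theorems.WeakCouplingHypercubicLimit.TraceNormColdPressure

/-- **Cold pressure forces the spectral ratio.**  Non-negative weights `λᵢ ≤ λ_{i₀}`,
`λ_{i₀} > 0`, `Σ λᵢ² < ∞`; if `(Σᵢ λᵢ^{m+2}) / λ_{i₀}^{m+2} − 1 ≤ V C e^{−g (m+2)}` for all
`m ≥ m₀` (any prefactor `V > 0`, any `C`, any real `g`), then `λᵢ ≤ e^{−g} λ_{i₀}` for every
`i ≠ i₀` (two terms of a sum of non-negative terms, `(m+2)`-th roots, `m → ∞`). [folklore] -/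
theorem stub_ratioOfColdPressure :
    ∀ (ι : Type) (lam : ι → ℝ) (i₀ : ι) (V C g : ℝ) (m₀ : ℕ),
      (∀ i, 0 ≤ lam i ∧ lam i ≤ lam i₀) → 0 < lam i₀ → Summable (fun i => lam i ^ 2) → 0 < V →
      (∀ m : ℕ, m₀ ≤ m → (∑' i, lam i ^ (m + 2)) / lam i₀ ^ (m + 2) - 1 ≤ V * C * Real.exp (-(g * ((m + 2 : ℕ) : ℝ)))) →
      ∀ i, i ≠ i₀ → lam i ≤ Real.exp (-g) * lam i₀ := by
  intro ι lam i₀ V C g m₀ hlam hpos hsum _hV hP i hi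
  by_contra hlt
  push Not at hlt
  -- `q := (λᵢ / λ_{i₀}) · e^{g} > 1`
  set q : ℝ := lam i / lam i₀ * Real.exp g with hq
  have hq1 : 1 < q := by
    have h1 : Real.exp (-g) * Real.exp g = 1 := by rw [← Real.exp_add]; simp
    have h2 : Real.exp (-g) < lam i / lam i₀ := by rw [lt_div_iff₀ hpos]; exact hlt
    calc (1 : ℝ) = Real.exp (-g) * Real.exp g := h1.symm
      _ < lam i / lam i₀ * Real.exp g := mul_lt_mul_of_pos_right h2 (Real.exp_pos g)
  -- summability of the higher powers: `λⱼ^{m+2} ≤ λ_{i₀}^m · λⱼ²`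
  have hsumm : ∀ m : ℕ, Summable (fun j => lam j ^ (m + 2)) := fun m => by
    refine (hsum.mul_left (lam i₀ ^ m)).of_nonneg_of_le (fun j => pow_nonneg (hlam j).1 _) ?_
    intro j
    rw [pow_add]
    exact mul_le_mul_of_nonneg_right (pow_le_pow_left₀ (hlam j).1 (hlam j).2 m)
      (pow_nonneg (hlam j).1 2)
  -- two non-negative terms of the sum
  have htwo : ∀ m : ℕ, lam i ^ (m + 2) + lam i₀ ^ (m + 2) ≤ ∑' j, lam j ^ (m + 2) := fun m => by
    classical
    have h := (hsumm m).sum_le_tsum {i, i₀} (fun j _ => pow_nonneg (hlam j).1 (m + 2))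
    rwa [Finset.sum_pair hi] at h
  -- for `m ≥ m₀`: `q ^ (m + 2) ≤ V C`
  have hkey : ∀ m : ℕ, m₀ ≤ m → q ^ (m + 2) ≤ V * C := by
    intro m hm
    have hPm := hP m hm
    have hpow : 0 < lam i₀ ^ (m + 2) := pow_pos hpos _
    have h2 : (lam i ^ (m + 2) + lam i₀ ^ (m + 2)) / lam i₀ ^ (m + 2) ≤
        (∑' j, lam j ^ (m + 2)) / lam i₀ ^ (m + 2) :=
      div_le_div_of_nonneg_right (htwo m) hpow.le
    have h3 : (lam i ^ (m + 2) + lam i₀ ^ (m + 2)) / lam i₀ ^ (m + 2) =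
        (lam i / lam i₀) ^ (m + 2) + 1 := by
      rw [add_div, div_self (ne_of_gt hpow), div_pow]
    have hρ : (lam i / lam i₀) ^ (m + 2) ≤ V * C * Real.exp (-(g * ((m + 2 : ℕ) : ℝ))) := by
      linarith
    have hmul := mul_le_mul_of_nonneg_right hρ (Real.exp_pos (g * ((m + 2 : ℕ) : ℝ))).le
    calc q ^ (m + 2) = (lam i / lam i₀) ^ (m + 2) * Real.exp (g * ((m + 2 : ℕ) : ℝ)) := by
          rw [hq, mul_pow, ← Real.exp_nat_mul, mul_comm ((m + 2 : ℕ) : ℝ) g]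
      _ ≤ V * C * Real.exp (-(g * ((m + 2 : ℕ) : ℝ))) * Real.exp (g * ((m + 2 : ℕ) : ℝ)) := hmul
      _ = V * C := by rw [mul_assoc, ← Real.exp_add]; simp
  -- but `q ^ m → ∞`
  have htend : Filter.Tendsto (fun m : ℕ => q ^ m) Filter.atTop Filter.atTop :=
    tendsto_pow_atTop_atTop_of_one_lt hq1
  obtain ⟨m, hm⟩ := Filter.tendsto_atTop_atTop.mp htend (V * C + 1)
  have h := hm (max m m₀ + 2) (by omega)
  have h' := hkey (max m m₀) (le_max_right _ _)
  linarith

end Summit.QuantumFields.YangMills.Theorems.WeakCouplingHypercubicLimit.TraceNormColdPressure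

end
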